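import Summits.BirchSwinnertonDyer.BirchSwinnertonDyer.Theses.TameQuarticSolvent
import Summits.BirchSwinnertonDyer.BirchSwinnertonDyer.Theorems.TameQuarticSolventSolventPairLowerBoundPairGivenGoodFieldOfLower
import Summits.BirchSwinnertonDyer.BirchSwinnertonDyer.Theorems.TameQuarticSolventSolventPairLowerBoundKolyvaginTwistedUpperAnalyticHalf
import HarnessLib

/-!
# Route `TameQuarticSolvent`, crux `SolventPairLowerBound` (stmt-BirchSwinnertonDyer-21391), line `birth` —
# the crux BY NAME from eight published inputs, K1⁻, K2a-ES₀ and K2a-rest (skeleton v6 without `sorry`)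

HONEST FRAMING. Theorems only; helper (`--supports stmt-BirchSwinnertonDyer-21391`), CONDITIONAL on all eleven
hypotheses; credits nothing toward closing the item and proves none of K1⁻ / K2a-ES₀ / K2a-rest. It is the
skeleton of record v6 (`Cruxes/SolventPairLowerBound/Lines/birth.lean`, lead tqs-p1 g3) with its four registered
stubs turned into displayed hypotheses, so that the tree (not only the crux workfile) records the current
decomposition of the deciding crux of route `TameQuarticSolvent`:
* PUB⁸ — eight named print facts BY NAME (modularity ×2, Gross–Zagier I.(7.3), Gross–Zagier–Kolyvagin,
  Dokchitser–Dokchitser/Milne `p`-part, Friedberg–Hoffstein Thm. B(1) over `ℚ` at `3` and over the real quadratic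
  `K` in the flip / no-flip classes);
* K1⁻ `LowerBSD3OverSolventQuartic` — the LOWER half of `BSD₃(E_M/M)` over the totally real tame quartic (OPEN);
* K2a-ES₀ `KolyvaginUpperRankZeroOverK` — the Euler-system half of K2a in analytic rank zero on the rows with an odd
  multiplicative prime (for the twist `E′ = (E_K)^{(β)}`, good supersingular at `𝔭 ∣ 3` by p584727/p586232, with
  `L(E′/K,1) ≠ 0`: `Ш[3^∞]` finite, `#Ш_an ∈ ℚ`, `ord₃ #Ш[3^∞] ≤ ord₃ #Ш_an`; sharp `3`-part NOT in print);
* K2a-rest `KolyvaginTwistedUpperOverKNoOddMult` — the v5 K2a text on the ≤ 71 classes without an odd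
  multiplicative prime.
Composition: w2's analytic half `exists_totallyPositive_oddAtThree_twist_L_ne_zero_of_friedbergHoffstein` (p584089)
+ K2a-ES₀ / K2a-rest give K2a; w3's `solventPairLowerBound_of_published_of_K1low_of_K2a` (p582415) gives the crux.
For the planner: a route-level split `21391 ⇐ K1⁻ · K2a-ES₀ · K2a-rest (+ PUB⁸ by name)` is closed by this theorem
in one line. BSD is not proved by any of this.

References: S. Friedberg, J. Hoffstein, Ann. of Math. 142 (1995) Thm. B; T. Dokchitser, V. Dokchitser, Ann. of Math.
172 (2010) Thm. 2.3; J. S. Milne, Invent. Math. 17 (1972) Thm. 1; B. Gross, D. Zagier, Invent. Math. 84 (1986)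
Thm. I.(7.3).
-/

-- D-0017: single-problem summit, so `Summit.BirchSwinnertonDyer.BirchSwinnertonDyer.…` repeats a namespace BY DESIGN.
set_option linter.dupNamespace false

noncomputable section

open scoped Classical NumberField

open WeierstrassCurve Literature.NumberTheory.EllipticCurves Literature.NumberTheory.EllipticCurves.ModularForms
  Literature.NumberTheory.EllipticCurves.Rank1Residual IsDedekindDomain NumberField

namespace Summit.BirchSwinnertonDyer.BirchSwinnertonDyer.Theorems.SolventPairLowerBound

/-- **K2a from its analytic half, K2a-ES₀ and K2a-rest** (skeleton v6's derivation, hypotheses displayed): GIVEN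
modularity (`hmod`), Friedberg–Hoffstein Thm. B(1) over the real quadratic field in the flip / no-flip classes
(`hFH`, `hFH'`), the rank-zero Euler-system half K2a-ES₀ on the rows with an odd multiplicative prime and K2a-rest on
the other rows, the v5 stub K2a («KolyvaginTwistedUpperOverK») holds — on the first rows with `Vβ` the twist
`(W_K)^{(β)}` itself. CONDITIONAL; credits nothing. [cite: FriedbergHoffstein1995, Thm. B (1)]
[cite: Kobayashi2002, Thm. 1.1 (i), (ii)] -/
theorem kolyvaginTwistedUpperOverK_of_analyticHalf_of_ES0_of_rest (hmod : exists_isNewformOf)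
    (hFH : friedbergHoffstein_exists_twist_ne_zero_realQuadratic_tameAtThree)
    (hFH' : friedbergHoffstein_exists_twist_ne_zero_realQuadratic_tameAtThree_noflip)
    (K2aES0 :
      ∀ (W : WeierstrassCurve ℚ) [W.IsElliptic] [W.IsGloballyMinimal],
        ¬ W.HasCM → Addv W 3 → Summit.BirchSwinnertonDyer.Rank1Residual.Additive.SubTprime W 3 →
        W.analyticRank = 1 →
        (∃ (ℓ₀ : ℕ) (_ : Fact ℓ₀.Prime), ℓ₀ ≠ 2 ∧ ℓ₀ ≠ 3 ∧ W.HasMultiplicativeReductionAtPrime ℓ₀) →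
        ∀ (d : ℤ), 0 < d → padicValInt 3 d = 1 →
        ∀ (K : Type) [Field K] [NumberField K] (θ₁ : K), Module.finrank ℚ K = 2 → θ₁ ^ 2 = (d : K) →
        ∀ β : K,
          (∀ v : HeightOneSpectrum (𝓞 K), ((3 : ℕ) : 𝓞 K) ∈ v.asIdeal →
            ∃ k : ℤ, v.valuation K β = WithZero.exp (2 * k + 1)) →
          (∀ σ : K →+* ℝ, 0 < σ β) →
          ((W.baseChange K).quadraticTwist β).HasEntireLFunction →
          ((W.baseChange K).quadraticTwist β).entireLFunction 1 ≠ 0 →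
          Finite (AddCommGroup.primaryComponent ((W.baseChange K).quadraticTwist β).sha 3) ∧
            ∃ qβ : ℚ, analyticSha ((W.baseChange K).quadraticTwist β) = (qβ : ℂ) ∧
              (padicValNat 3
                  (Nat.card (AddCommGroup.primaryComponent ((W.baseChange K).quadraticTwist β).sha 3)) : ℤ) ≤
                padicValRat 3 qβ)
    (K2aRest :
      ∀ (W : WeierstrassCurve ℚ) [W.IsElliptic] [W.IsGloballyMinimal],
        ¬ W.HasCM → Addv W 3 → Summit.BirchSwinnertonDyer.Rank1Residual.Additive.SubTprime W 3 →
        W.analyticRank = 1 →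
        ¬ (∃ (ℓ₀ : ℕ) (_ : Fact ℓ₀.Prime), ℓ₀ ≠ 2 ∧ ℓ₀ ≠ 3 ∧ W.HasMultiplicativeReductionAtPrime ℓ₀) →
        ∀ (d : ℤ), 0 < d → padicValInt 3 d = 1 →
        ∀ (K : Type) [Field K] [NumberField K] (θ₁ : K), Module.finrank ℚ K = 2 → θ₁ ^ 2 = (d : K) →
          ∃ β : K,
            (∀ v : HeightOneSpectrum (𝓞 K), ((3 : ℕ) : 𝓞 K) ∈ v.asIdeal →
              ∃ k : ℤ, v.valuation K β = WithZero.exp (2 * k + 1)) ∧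
            (∀ σ : K →+* ℝ, 0 < σ β) ∧
            ∃ (Vβ : WeierstrassCurve K) (_ : Vβ.IsElliptic),
              (∃ C : WeierstrassCurve.VariableChange K, C • (W.baseChange K).quadraticTwist β = Vβ) ∧
              Vβ.HasEntireLFunction ∧
              Finite (AddCommGroup.primaryComponent Vβ.sha 3) ∧
              ∃ qβ : ℚ, analyticSha Vβ = (qβ : ℂ) ∧
                (padicValNat 3 (Nat.card (AddCommGroup.primaryComponent Vβ.sha 3)) : ℤ) ≤
                  padicValRat 3 qβ) :
    ∀ (W : WeierstrassCurve ℚ) [W.IsElliptic] [W.IsGloballyMinimal],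
      ¬ W.HasCM → Addv W 3 → Summit.BirchSwinnertonDyer.Rank1Residual.Additive.SubTprime W 3 →
      W.analyticRank = 1 →
      ∀ (d : ℤ), 0 < d → padicValInt 3 d = 1 →
      ∀ (K : Type) [Field K] [NumberField K] (θ₁ : K), Module.finrank ℚ K = 2 → θ₁ ^ 2 = (d : K) →
        ∃ β : K,
          (∀ v : HeightOneSpectrum (𝓞 K), ((3 : ℕ) : 𝓞 K) ∈ v.asIdeal →
            ∃ k : ℤ, v.valuation K β = WithZero.exp (2 * k + 1)) ∧
          (∀ σ : K →+* ℝ, 0 < σ β) ∧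
          ∃ (Vβ : WeierstrassCurve K) (_ : Vβ.IsElliptic),
            (∃ C : WeierstrassCurve.VariableChange K, C • (W.baseChange K).quadraticTwist β = Vβ) ∧
            Vβ.HasEntireLFunction ∧
            Finite (AddCommGroup.primaryComponent Vβ.sha 3) ∧
            ∃ qβ : ℚ, analyticSha Vβ = (qβ : ℂ) ∧
              (padicValNat 3 (Nat.card (AddCommGroup.primaryComponent Vβ.sha 3)) : ℤ) ≤
                padicValRat 3 qβ := by
  intro W _ _ hCM hadd hsub hr d hd0 hd K _ _ θ₁ h2 hθ₁
  by_cases hmult : ∃ (ℓ₀ : ℕ) (_ : Fact ℓ₀.Prime), ℓ₀ ≠ 2 ∧ ℓ₀ ≠ 3 ∧ W.HasMultiplicativeReductionAtPrime ℓ₀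
  · obtain ⟨β, hval, hpos, hL, hL1⟩ :=
      exists_totallyPositive_oddAtThree_twist_L_ne_zero_of_friedbergHoffstein hmod hFH hFH'
        W hCM hadd hsub hr hmult d hd0 hd K θ₁ h2 hθ₁
    obtain ⟨hfin, qβ, hqβ, hle⟩ := K2aES0 W hCM hadd hsub hr hmult d hd0 hd K θ₁ h2 hθ₁ β hval hpos hL hL1
    have hβ0 : β ≠ 0 := by
      intro h0
      obtain ⟨v, hv⟩ := exists_heightOneSpectrum_natCast_mem K 3
      obtain ⟨k, hk⟩ := hval v hv
      rw [h0, map_zero] at hk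
      exact WithZero.exp_ne_zero hk.symm
    haveI : (W.baseChange K).IsElliptic := by rw [WeierstrassCurve.baseChange]; infer_instance
    haveI : NeZero (2 : K) := ⟨two_ne_zero⟩
    exact ⟨β, hval, hpos, (W.baseChange K).quadraticTwist β, isElliptic_quadraticTwist _ hβ0,
      ⟨1, one_smul _ _⟩, hL, hfin, qβ, hqβ, hle⟩
  · exact K2aRest W hCM hadd hsub hr hmult d hd0 hd K θ₁ h2 hθ₁

/-- **Crux `SolventPairLowerBound` BY NAME from eight published inputs, K1⁻, K2a-ES₀ and K2a-rest** — skeleton v6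
of line `birth` without `sorry` (w3's `solventPairLowerBound_of_published_of_K1low_of_K2a`, p582415, fed by
`kolyvaginTwistedUpperOverK_of_analyticHalf_of_ES0_of_rest`). CONDITIONAL on all hypotheses; credits nothing toward
closing the item; the one-line closer of a route-level split `21391 ⇐ K1⁻ · K2a-ES₀ · K2a-rest`.
[cite: DokchitserDokchitserAnnals2010, §2.1 Thm. 2.3] [cite: FriedbergHoffstein1995, Thm. B (1)]
[cite: GrossZagier1986, Thm. I.(7.3)] [cite: Milne1972ArithmeticAV, §1 Thm. 1] -/
theorem solventPairLowerBound_of_published_of_K1low_of_K2aES0_of_K2aRest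
    (hPUB :
      exists_isNewformOf ∧ nonempty_modularParametrizationData ∧ GrossZagier1986_thm_I_7_3 ∧
        rank_eq_analyticRank_of_analyticRank_le_one ∧
        Milne1972.bsdQuotientP_baseChange_relQuadratic_anyModel ∧
        friedbergHoffstein_exists_pos_twist_ne_zero_ramifiedAtThree ∧
        friedbergHoffstein_exists_twist_ne_zero_realQuadratic_tameAtThree ∧
        friedbergHoffstein_exists_twist_ne_zero_realQuadratic_tameAtThree_noflip)
    (K1low :
      ∀ (W : WeierstrassCurve ℚ) [W.IsElliptic] [W.IsGloballyMinimal],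
        ¬ W.HasCM → Addv W 3 → Summit.BirchSwinnertonDyer.Rank1Residual.Additive.SubTprime W 3 →
        W.analyticRank = 1 →
        ∀ (K : Type) [Field K] [NumberField K] (M : Type) [Field M] [NumberField M] [Algebra K M],
          Module.finrank ℚ K = 2 → Module.finrank K M = 2 → IsTotallyReal M →
          (∀ w : HeightOneSpectrum (𝓞 M), ((3 : ℕ) : 𝓞 M) ∈ w.asIdeal →
            w.asIdeal.ramificationIdx ℤ = 4) →
          (∀ w : HeightOneSpectrum (𝓞 M), ((3 : ℕ) : 𝓞 M) ∈ w.asIdeal →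
            (W.baseChange M).HasGoodReductionAt w) →
          Finite (AddCommGroup.primaryComponent (W.baseChange M).sha 3) →
          ∀ qM : ℚ, analyticSha (W.baseChange M) = (qM : ℂ) →
            padicValRat 3 qM ≤
              padicValNat 3 (Nat.card (AddCommGroup.primaryComponent (W.baseChange M).sha 3)))
    (K2aES0 :
      ∀ (W : WeierstrassCurve ℚ) [W.IsElliptic] [W.IsGloballyMinimal],
        ¬ W.HasCM → Addv W 3 → Summit.BirchSwinnertonDyer.Rank1Residual.Additive.SubTprime W 3 →
        W.analyticRank = 1 →
        (∃ (ℓ₀ : ℕ) (_ : Fact ℓ₀.Prime), ℓ₀ ≠ 2 ∧ ℓ₀ ≠ 3 ∧ W.HasMultiplicativeReductionAtPrime ℓ₀) →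
        ∀ (d : ℤ), 0 < d → padicValInt 3 d = 1 →
        ∀ (K : Type) [Field K] [NumberField K] (θ₁ : K), Module.finrank ℚ K = 2 → θ₁ ^ 2 = (d : K) →
        ∀ β : K,
          (∀ v : HeightOneSpectrum (𝓞 K), ((3 : ℕ) : 𝓞 K) ∈ v.asIdeal →
            ∃ k : ℤ, v.valuation K β = WithZero.exp (2 * k + 1)) →
          (∀ σ : K →+* ℝ, 0 < σ β) →
          ((W.baseChange K).quadraticTwist β).HasEntireLFunction →
          ((W.baseChange K).quadraticTwist β).entireLFunction 1 ≠ 0 →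
          Finite (AddCommGroup.primaryComponent ((W.baseChange K).quadraticTwist β).sha 3) ∧
            ∃ qβ : ℚ, analyticSha ((W.baseChange K).quadraticTwist β) = (qβ : ℂ) ∧
              (padicValNat 3
                  (Nat.card (AddCommGroup.primaryComponent ((W.baseChange K).quadraticTwist β).sha 3)) : ℤ) ≤
                padicValRat 3 qβ)
    (K2aRest :
      ∀ (W : WeierstrassCurve ℚ) [W.IsElliptic] [W.IsGloballyMinimal],
        ¬ W.HasCM → Addv W 3 → Summit.BirchSwinnertonDyer.Rank1Residual.Additive.SubTprime W 3 →
        W.analyticRank = 1 →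
        ¬ (∃ (ℓ₀ : ℕ) (_ : Fact ℓ₀.Prime), ℓ₀ ≠ 2 ∧ ℓ₀ ≠ 3 ∧ W.HasMultiplicativeReductionAtPrime ℓ₀) →
        ∀ (d : ℤ), 0 < d → padicValInt 3 d = 1 →
        ∀ (K : Type) [Field K] [NumberField K] (θ₁ : K), Module.finrank ℚ K = 2 → θ₁ ^ 2 = (d : K) →
          ∃ β : K,
            (∀ v : HeightOneSpectrum (𝓞 K), ((3 : ℕ) : 𝓞 K) ∈ v.asIdeal →
              ∃ k : ℤ, v.valuation K β = WithZero.exp (2 * k + 1)) ∧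
            (∀ σ : K →+* ℝ, 0 < σ β) ∧
            ∃ (Vβ : WeierstrassCurve K) (_ : Vβ.IsElliptic),
              (∃ C : WeierstrassCurve.VariableChange K, C • (W.baseChange K).quadraticTwist β = Vβ) ∧
              Vβ.HasEntireLFunction ∧
              Finite (AddCommGroup.primaryComponent Vβ.sha 3) ∧
              ∃ qβ : ℚ, analyticSha Vβ = (qβ : ℂ) ∧
                (padicValNat 3 (Nat.card (AddCommGroup.primaryComponent Vβ.sha 3)) : ℤ) ≤
                  padicValRat 3 qβ) :
    Summit.BirchSwinnertonDyer.BirchSwinnertonDyer.Theses.TameQuarticSolvent.SolventPairLowerBound :=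
  solventPairLowerBound_of_published_of_K1low_of_K2a hPUB.1 hPUB.2.1 hPUB.2.2.1 hPUB.2.2.2.1 hPUB.2.2.2.2.1
    hPUB.2.2.2.2.2.1 K1low
    (kolyvaginTwistedUpperOverK_of_analyticHalf_of_ES0_of_rest hPUB.1 hPUB.2.2.2.2.2.2.1 hPUB.2.2.2.2.2.2.2
      K2aES0 K2aRest)

end Summit.BirchSwinnertonDyer.BirchSwinnertonDyer.Theorems.SolventPairLowerBound

end
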